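import Summits.Ventures.PercRepro.ClassVdBHKHarris

/-!
# PercRepro — relabelling the marks: a class theorem for one placement is one for its whole `S₄`-orbit (typer-2, gen 7)

The 246 theorems of `ClassVdBHKHarris1–4` prove one REPRESENTATIVE placement per INSIDE orbit of C-024. The
`S₄`-orbit of a placement `(S, T, f, g)` under the mark permutations `π` consists of the placements
`(π S, π T, f ∘ rowPerm π, g ∘ rowPerm π)`, and this file transports the class theorem along `π`:

* `rowPerm π s` — the row obtained from `s` by relabelling the marks: `rowConn (rowPerm π s) i j = rowConn s (π i) (π j)`
  (**`rowConn_rowPerm`**, through `rowOf4_eq_iff`); `rowPerm_rowPerm_symm`, `row_ext` (rows are their literals);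
* **`MultiGraph.row4_markedPartition_comp`** — the row of the marking `m ∘ π` is `rowPerm π` of the row of `m`;
* **`classNonneg_rowPerm`** — `ClassNonneg K → ClassNonneg (K ∘ (rowPerm π × rowPerm π))` (apply the face inequality
  to the permuted marks);
* `sepRows_map` / `sepFromRows_map`, `litVec21_map` / `starVec11_map`, **`kernel21_map`** / **`kernel11_map`**
  (the relabelled placement's kernel is the representative's kernel read through `rowPerm π`),
  **`isMonoLit21_map`** / **`isMonoStar11_map`** (admissibility transports);
* **`thm21ClassThm_map`** / **`thm11ClassThm_map`**: `Thm21ClassThm S T f g → Thm21ClassThm (S.map π) (T.map π)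
  (f ∘ rowPerm π) (g ∘ rowPerm π)` and the Theorem 1.1 analogue — so every `c024_inside_NNN` covers its orbit
  (4,304 of the 5,609 placements in all).
-/

namespace PercRepro

open Finset

/-! ### Rows under a mark permutation -/

/-- The atom vector of the row `s` read through the mark permutation `π`: atom `(i, j)` is `s`'s literal `π i ~ π j`. -/
def permAtoms (π : Equiv.Perm (Fin 4)) (s : Fin 15) : Fin 6 → Bool :=
  fun a => decide (rgs4 s (π (pair4 a).1) = rgs4 s (π (pair4 a).2))

/-- The rebuilt relation of `permAtoms π s` is the relabelled literal. -/
theorem relOf4_permAtoms (π : Equiv.Perm (Fin 4)) (s : Fin 15) (i j : Fin 4) :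
    relOf4 (permAtoms π s) i j = decide (rgs4 s (π i) = rgs4 s (π j)) := by
  fin_cases i <;> fin_cases j <;>
    first
    | rfl
    | exact (decide_eq_true rfl).symm
    | exact decide_eq_decide.mpr eq_comm

/-- `permAtoms π s` is transitive. -/
theorem isEquivAtoms4_permAtoms (π : Equiv.Perm (Fin 4)) (s : Fin 15) : IsEquivAtoms4 (permAtoms π s) := by
  intro x y z hxy hyz
  rw [relOf4_permAtoms, decide_eq_true_iff] at hxy hyz ⊢
  exact hxy.trans hyz

/-- The row `s` relabelled by the mark permutation `π`: its literal `i ~ j` is `s`'s literal `π i ~ π j`. -/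
def rowPerm (π : Equiv.Perm (Fin 4)) (s : Fin 15) : Fin 15 := rowOf4 (permAtoms π s)

/-- The atoms of `rowPerm π s` are `permAtoms π s`. -/
theorem rows4_rowPerm (π : Equiv.Perm (Fin 4)) (s : Fin 15) : rows4 (rowPerm π s) = permAtoms π s :=
  ((rowOf4_eq_iff _ (isEquivAtoms4_permAtoms π s) _).mp rfl).symm

/-- A row's literals are the rebuilt relation of its atoms. -/
theorem rowConn_eq_relOf4_rows4 : ∀ (t : Fin 15) (i j : Fin 4), rowConn t i j = relOf4 (rows4 t) i j := by
  decide

/-- **The literals of the relabelled row**: `rowConn (rowPerm π s) i j = rowConn s (π i) (π j)`. -/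
theorem rowConn_rowPerm (π : Equiv.Perm (Fin 4)) (s : Fin 15) (i j : Fin 4) :
    rowConn (rowPerm π s) i j = rowConn s (π i) (π j) := by
  rw [rowConn_eq_relOf4_rows4, rows4_rowPerm, relOf4_permAtoms]
  rfl

/-- Rows are determined by their literals. -/
theorem row_ext : ∀ t t' : Fin 15, (∀ i j : Fin 4, rowConn t i j = rowConn t' i j) → t = t' := by
  decide

/-- `rowPerm π⁻¹` undoes `rowPerm π`. -/
theorem rowPerm_symm_rowPerm (π : Equiv.Perm (Fin 4)) (s : Fin 15) : rowPerm π.symm (rowPerm π s) = s := by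
  apply row_ext
  intro i j
  rw [rowConn_rowPerm, rowConn_rowPerm, Equiv.apply_symm_apply, Equiv.apply_symm_apply]

/-- `rowPerm π` undoes `rowPerm π⁻¹`. -/
theorem rowPerm_rowPerm_symm (π : Equiv.Perm (Fin 4)) (s : Fin 15) : rowPerm π (rowPerm π.symm s) = s := by
  apply row_ext
  intro i j
  rw [rowConn_rowPerm, rowConn_rowPerm, Equiv.symm_apply_apply, Equiv.symm_apply_apply]

/-! ### The row of a relabelled marking -/

namespace MultiGraph

variable {V E : Type*} (G : MultiGraph V E)

/-- **The row of the marking `m ∘ π` is `rowPerm π` of the row of `m`.** -/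
theorem row4_markedPartition_comp (ω : Config E) (m : Fin 4 → V) (π : Equiv.Perm (Fin 4)) :
    row4 (G.markedPartition ω (m ∘ π)) = rowPerm π (row4 (G.markedPartition ω m)) := by
  classical
  apply row_ext
  intro i j
  rw [rowConn_rowPerm, rowConn_row4_markedPartition, rowConn_row4_markedPartition]
  rfl

end MultiGraph

/-- The marking `![a, b, c, d] ∘ π` as a vector. -/
theorem vec_comp_perm {V : Type*} (a b c d : V) (π : Equiv.Perm (Fin 4)) :
    (![a, b, c, d] ∘ π) = ![(![a, b, c, d] : Fin 4 → V) (π 0), (![a, b, c, d] : Fin 4 → V) (π 1),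
      (![a, b, c, d] : Fin 4 → V) (π 2), (![a, b, c, d] : Fin 4 → V) (π 3)] := by
  funext i
  fin_cases i <;> rfl

/-- **Class-nonnegativity is invariant under relabelling the marks**: if `K` is class-nonnegative, so is
`(s, t) ↦ K (rowPerm π s) (rowPerm π t)`. -/
theorem classNonneg_rowPerm (π : Equiv.Perm (Fin 4)) {K : Fin 15 → Fin 15 → ℝ} (hK : ClassNonneg K) :
    ClassNonneg fun s t => K (rowPerm π s) (rowPerm π t) := by
  intro V E _ _ G a b c d u v huv
  have h := hK G ((![a, b, c, d] : Fin 4 → V) (π 0)) ((![a, b, c, d] : Fin 4 → V) (π 1))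
    ((![a, b, c, d] : Fin 4 → V) (π 2)) ((![a, b, c, d] : Fin 4 → V) (π 3)) u v huv
  rw [← vec_comp_perm] at h
  simp only [G.row4_markedPartition_comp] at h
  exact h

/-! ### Relabelling a placement -/

/-- `Q = {S ↮ T}` on the relabelled placement reads the original on the relabelled row. -/
theorem sepRows_map (π : Equiv.Perm (Fin 4)) (S T : Finset (Fin 4)) (s : Fin 15) :
    sepRows (S.map π.toEmbedding) (T.map π.toEmbedding) s = sepRows S T (rowPerm π s) := by
  unfold sepRows
  refine decide_eq_decide.mpr ?_
  simp only [Finset.forall_mem_map, Equiv.coe_toEmbedding, rowConn_rowPerm]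

/-- `R_X = {s ↮ X}` on the relabelled placement reads the original on the relabelled row. -/
theorem sepFromRows_map (π : Equiv.Perm (Fin 4)) (s : Fin 4) (X : Finset (Fin 4)) (p : Fin 15) :
    sepFromRows (π s) (X.map π.toEmbedding) p = sepFromRows s X (rowPerm π p) := by
  unfold sepFromRows
  refine decide_eq_decide.mpr ?_
  simp only [Finset.forall_mem_map, Equiv.coe_toEmbedding, rowConn_rowPerm]

/-- **The kernel of the relabelled Theorem 2.1 placement** is the original kernel read through `rowPerm π`. -/
theorem kernel21_map (π : Equiv.Perm (Fin 4)) (S T : Finset (Fin 4)) (f g : Fin 15 → Bool) (s t : Fin 15) :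
    kernel21 (S.map π.toEmbedding) (T.map π.toEmbedding) (f ∘ rowPerm π) (g ∘ rowPerm π) s t =
      kernel21 S T f g (rowPerm π s) (rowPerm π t) := by
  simp only [kernel21, sepRows_map, Function.comp]

/-- **The kernel of the relabelled Theorem 1.1 placement** is the original kernel read through `rowPerm π`. -/
theorem kernel11_map (π : Equiv.Perm (Fin 4)) (s : Fin 4) (A B : Fin 15 → Bool) (X Y : Finset (Fin 4))
    (p q : Fin 15) :
    kernel11 (π s) (A ∘ rowPerm π) (B ∘ rowPerm π) (X.map π.toEmbedding) (Y.map π.toEmbedding) p q =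
      kernel11 s A B X Y (rowPerm π p) (rowPerm π q) := by
  simp only [kernel11, ← Finset.map_inter, ← Finset.map_union, sepFromRows_map, Function.comp]

/-- The increasing literals of the relabelled placement. -/
theorem fLits21_map (π : Equiv.Perm (Fin 4)) (S T : Finset (Fin 4)) (i j : Fin 4) :
    fLits21 (S.map π.toEmbedding) (T.map π.toEmbedding) (π i, π j) ↔ fLits21 S T (i, j) := by
  simp only [fLits21, Finset.mem_map_equiv, Equiv.symm_apply_apply, ne_eq, EmbeddingLike.apply_eq_iff_eq]

/-- The decreasing literals of the relabelled placement. -/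
theorem gLits21_map (π : Equiv.Perm (Fin 4)) (S T : Finset (Fin 4)) (i j : Fin 4) :
    gLits21 (S.map π.toEmbedding) (T.map π.toEmbedding) (π i, π j) ↔ gLits21 S T (i, j) := by
  simp only [gLits21, Finset.mem_map_equiv, Equiv.symm_apply_apply, ne_eq, EmbeddingLike.apply_eq_iff_eq]

/-- The joint literal vector of the relabelled placement at the relabelled literal. -/
theorem litVec21_map (π : Equiv.Perm (Fin 4)) (S T : Finset (Fin 4)) (s : Fin 15) (i j : Fin 4) :
    litVec21 (S.map π.toEmbedding) (T.map π.toEmbedding) s (π i, π j) = litVec21 S T (rowPerm π s) (i, j) := by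
  unfold litVec21
  simp only [fLits21_map, gLits21_map, rowConn_rowPerm]

/-- The star literals of the relabelled placement. -/
theorem starLits11_map (π : Equiv.Perm (Fin 4)) (s i j : Fin 4) :
    starLits11 (π s) (π i, π j) ↔ starLits11 s (i, j) := by
  simp only [starLits11, ne_eq, EmbeddingLike.apply_eq_iff_eq]

/-- The star literal vector of the relabelled placement at the relabelled literal. -/
theorem starVec11_map (π : Equiv.Perm (Fin 4)) (s : Fin 4) (p : Fin 15) (i j : Fin 4) :
    starVec11 (π s) p (π i, π j) = starVec11 s (rowPerm π p) (i, j) := by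
  unfold starVec11
  simp only [starLits11_map, rowConn_rowPerm]

/-- Reindexing a literal vector by `π` is monotone. -/
theorem monotone_reindex (π : Equiv.Perm (Fin 4)) :
    Monotone fun x : Fin 4 × Fin 4 → Bool => fun ij : Fin 4 × Fin 4 => x (π ij.1, π ij.2) :=
  fun _ _ h ij => h (π ij.1, π ij.2)

/-- **Admissibility transports**: `f ∘ rowPerm π` is admissible for the relabelled Theorem 2.1 placement. -/
theorem isMonoLit21_map (π : Equiv.Perm (Fin 4)) {S T : Finset (Fin 4)} {f : Fin 15 → Bool}
    (hf : IsMonoLit21 S T f) :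
    IsMonoLit21 (S.map π.toEmbedding) (T.map π.toEmbedding) (f ∘ rowPerm π) := by
  obtain ⟨φ, hφ, hf⟩ := hf
  refine ⟨fun x => φ fun ij => x (π ij.1, π ij.2), hφ.comp (monotone_reindex π), fun s => ?_⟩
  simp only [Function.comp, hf]
  congr 1
  funext ij
  rw [litVec21_map]

/-- **Admissibility transports**: `A ∘ rowPerm π` is admissible for the relabelled Theorem 1.1 placement. -/
theorem isMonoStar11_map (π : Equiv.Perm (Fin 4)) {s : Fin 4} {A : Fin 15 → Bool} (hA : IsMonoStar11 s A) :
    IsMonoStar11 (π s) (A ∘ rowPerm π) := by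
  obtain ⟨φ, hφ, hA⟩ := hA
  refine ⟨fun x => φ fun ij => x (π ij.1, π ij.2), hφ.comp (monotone_reindex π), fun p => ?_⟩
  simp only [Function.comp, hA]
  congr 1
  funext ij
  rw [starVec11_map]

/-- **A class theorem for a Theorem 2.1 placement is one for every relabelling of it.** -/
theorem thm21ClassThm_map (π : Equiv.Perm (Fin 4)) {S T : Finset (Fin 4)} {f g : Fin 15 → Bool}
    (h : Thm21ClassThm S T f g) :
    Thm21ClassThm (S.map π.toEmbedding) (T.map π.toEmbedding) (f ∘ rowPerm π) (g ∘ rowPerm π) := by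
  obtain ⟨hf, hg, hK⟩ := h
  refine ⟨isMonoLit21_map π hf, isMonoLit21_map π hg, ?_⟩
  intro V E _ _ G a b c d u v huv
  have h := classNonneg_rowPerm π (K := fun s t => (kernel21 S T f g s t : ℝ)) hK G a b c d u v huv
  simp only [kernel21_map]
  exact h

/-- **A class theorem for a Theorem 1.1 placement is one for every relabelling of it.** -/
theorem thm11ClassThm_map (π : Equiv.Perm (Fin 4)) {s : Fin 4} {A B : Fin 15 → Bool} {X Y : Finset (Fin 4)}
    (h : Thm11ClassThm s A B X Y) :
    Thm11ClassThm (π s) (A ∘ rowPerm π) (B ∘ rowPerm π) (X.map π.toEmbedding) (Y.map π.toEmbedding) := by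
  obtain ⟨hA, hB, hK⟩ := h
  refine ⟨isMonoStar11_map π hA, isMonoStar11_map π hB, ?_⟩
  intro V E _ _ G a b c d u v huv
  have h := classNonneg_rowPerm π (K := fun p q => (kernel11 s A B X Y p q : ℝ)) hK G a b c d u v huv
  simp only [kernel11_map]
  exact h

end PercRepro
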